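import Mathlib
import Summits.KontsevichZagierPeriods.Zeta5Search.TSOriginDataO62A
import HarnessLib

/-!
# ζ(5) search — data of gen-2 g13's ORIGIN type-space window `M = 62` (`14 * n < 17 * p`,
    `6 * p ≤ 5 * n`) (part 7/9) (HONEST FRAMING: systematic search; no irrationality claim unless certified)

Cell `pub-zeta5`, prover seat p3 generation 3 (generated by `code/gen/tsdata.py`).  Inventory of the window (all odd `p`, `n ≤ 150`,
    `code/gen/tswin.py`):
deep types `D62` (3), centre-free sub-deep types `S62` (6), odd-centre types `P62` (0); ALL type-level doubled orbit points lie on ONE line: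
primitive direction `u62 = (39549306551943765531317081836159930667824438816181760000, -60005993380462402421439513912491821413290079887218406539)`,
    `Φ_u = u₁V − u₂W = c62 = -588720717425722350870523333045959528181351991373259552158245384644339/125677405417868831586847005690612940800000000`; every deep orbit vector is `∥ u62`.  Each identity is PROVED by the computable
mirror `TypeEval.typeRho_eq_typeRhoC` + `decide +kernel`; `lineData62 : LineData u62 c62 D62 S62 P62` feeds `OriginWindows.deep_dir/lineVal_live`
in the machine file `TSWindowO62.lean` (`ResidueLaw.RecTSClassesO62`, `RecWindowTSM62`).  Rational bookkeeping; nothing here bears on irrationality.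
-/

noncomputable section

open Finset

namespace Summit.KontsevichZagierPeriods.Zeta5Search.OriginWindows

open Summit.KontsevichZagierPeriods.Zeta5Search.SecondOrder
open Summit.KontsevichZagierPeriods.Zeta5Search.LevelClass (typeW typeV)
open Summit.KontsevichZagierPeriods.Zeta5Search.ZeroWindows (deepPoint pairPoint)
open Summit.KontsevichZagierPeriods.Zeta5Search.TypeEval (typeRho_eq_typeRhoC)

variable {p : ℕ} [hp : Fact p.Prime]

set_option maxHeartbeats 16000000 in
/-- Line datum (`M = 62`): sub-deep type 5, pair point on the line. -/
theorem s62_pt_5 : lineVal u62 (pairPoint [1, 1, 1, 1, 1, 1, 1, 1, 1, 1, 1, 1, 1, 0, -1, -1, -2, -3, -4, -5, -5, -6, -6, -6, -6, -6, -6, -6, -6, -5,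
    -4, -3, -3, -2, -1, 0, 1, 1, 1, 1, 1, 1, 1, 1, 1, 1, 1, 1, 1]) = c62 := by
  unfold lineVal ZeroWindows.pairPoint LevelClass.typeW LevelClass.typeV; simp only [typeRho_eq_typeRhoC]; decide +kernel

set_option maxHeartbeats 16000000 in
/-- Line datum (`M = 62`): sub-deep type 6, pair point on the line. -/
theorem s62_pt_6 : lineVal u62 (pairPoint [1, 1, 1, 1, 1, 1, 1, 1, 1, 1, 1, 1, 1, 0, -1, -2, -3, -3, -4, -5, -6, -6, -6, -6, -6, -6, -6, -6, -5, -5,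
    -4, -3, -2, -1, -1, 0, 1, 1, 1, 1, 1, 1, 1, 1, 1, 1, 1, 1, 1]) = c62 := by
  unfold lineVal ZeroWindows.pairPoint LevelClass.typeW LevelClass.typeV; simp only [typeRho_eq_typeRhoC]; decide +kernel

end Summit.KontsevichZagierPeriods.Zeta5Search.OriginWindows

end
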